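import Mathlib
import HarnessLib
import Summits.ResolutionOfSingularities.ResolutionOfSingularities.Theorems.WildQuotientsWildQuotientResolutionS1aProducerNode
import Summits.ResolutionOfSingularities.ResolutionOfSingularities.Theorems.WildQuotientsWildQuotientResolutionS1aKillFreeKN

/-!
# S1a — K-FREE FRAME, (F-T8) assembly: the EXPLICIT ATLAS of a MOVE (producer norm charts ∪ old charts restricted off the support) and its formal-locus bound

[OURS · L1 W4.5c · lead-1 g12; plan-1 RULING R-F15b (1) «every INNER node of a master tree is a MOVE node: `IsAdmissibleCentre` + ∀ M′ (IsMoveOf), ∃ 𝔄′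
with 𝔄′ := the EXPLICIT atlas = ALL norm charts of the blow-up (killed or not) ∪ restrictions of the previous atlas off supp», (3) «UPPER BOUND AT A
RESIDUAL NODE: F′ ⊆ ⋃_C V(H_C)», (6); A-KF v1 §2.1 «T_{i+1} ⊇ π⁻¹(T_i ∖ supp) ∪ Res_{i+1}»] — NOT statements of the manuscript; counted 0; AI-level work,
weaker than expert review. Crux stmt-ResolutionOfSingularities-17941 `CyclicQuotientFourfolds`, line `s1a-logminvertex` v12 (`stub_reachLowerInF`).

THE A-SIDE TWIN OF `exists_killAtlas`. Data: a move `π′ : M′ → M` along `(𝒦, d)` (equivariant blow-up of the `G`-stable `𝒦_d`); ONE centre chart `O`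
CONTAINING THE SUPPORT with explicit node `(B, 𝒜, σ, e)` and centre `(f, w)` (trace `𝒦|_O`, Veronese degree `d`); a σ-fixed cover `y_j ∈ K_{dk}`
generating up to radical (`hrad`); for each `j` a «residual» set `R_j ⊆ M′` OUTSIDE WHICH the producer node of the chart `W_j = M′[O, e⁻¹ y_j]` is
certified principal — the hypothesis `hR` quantifies over EVERY pinned node structure `(E, tame, intertwine, pin)` of `W_j` (as delivered by
`exists_nodeData_blowupChart_pin`), so the instance discharges it with `principalNear_producerChart_of_certificate` from identities in the chart ring.
* ★★ `exists_moveAtlas` — an atlas `𝔄′` on `M′` (the producer charts `W_j` with their exposed nodes ∪ the transfers of the restrictions `(𝔄.D i)|_{D(b)}`,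
  `D(b) ⊆ O_i ∖ supp` invariant) with the UPPER BOUND `F_𝔄′ ⊆ π′⁻¹(F_𝔄 ∖ O) ∪ ⋃_j (W_j ∩ R_j)`;
* `exists_moveAtlas_subset` — the bound in the tracked form `F_𝔄′ ⊆ π′⁻¹(T ∖ O) ∪ ⋃_j (W_j ∩ R_j)` for any `T ⊇ F_𝔄` (X-scheme bookkeeping).
-/

set_option linter.dupNamespace false

noncomputable section

open CategoryTheory Limits AlgebraicGeometry TopologicalSpace Topology
open Literature.AlgebraicGeometry.Resolution Literature.AlgebraicGeometry.RelativeSpec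
open Summit.ResolutionOfSingularities.ResolutionOfSingularities.Theorems.WildQuotientResolution.S1
open Summit.ResolutionOfSingularities.ResolutionOfSingularities.Theorems.WildQuotientResolution.S1.NodeAtlas
open Summit.ResolutionOfSingularities.ResolutionOfSingularities.Theorems.WildQuotientResolution.S1.CoarseChart
open Summit.ResolutionOfSingularities.ResolutionOfSingularities.Theorems.WildQuotientResolution.S1.ProducerStep
open Summit.ResolutionOfSingularities.ResolutionOfSingularities.Theorems.WildQuotientResolution.S1.NpFrame
open Summit.ResolutionOfSingularities.ResolutionOfSingularities.Theorems.WildQuotientResolution.S1.GoodCharts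
open Summit.ResolutionOfSingularities.ResolutionOfSingularities.Theorems.WildQuotientResolution.S1.NodeChartAway
open Summit.ResolutionOfSingularities.ResolutionOfSingularities.Theorems.WildQuotientResolution.S1.KillableTransport
open Summit.ResolutionOfSingularities.ResolutionOfSingularities.Theorems.WildQuotientResolution.S1.BlowupCharts
open Summit.ResolutionOfSingularities.ResolutionOfSingularities.Theorems.WildQuotientResolution.BlowupExit

namespace Summit.ResolutionOfSingularities.ResolutionOfSingularities.Theorems.WildQuotientResolution.S1.GameFrame.GModel

variable {p : ℕ} {X' X₁ : Scheme.{0}} {q : X' ⟶ X₁} {G : Type} [Group G] {ρ : G →* Aut X'} {g₀ : G}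

set_option maxHeartbeats 800000 in
/-- ★★ **THE EXPLICIT ATLAS OF A MOVE and its formal-locus bound.** For a move `π′ : M′ → M` along the `G`-stable centre `(𝒦, d)`, ONE centre chart `O ⊇ supp 𝒦_d`
with explicit node/centre data, a σ-fixed cover `(k, y_j)` of Veronese degree `d·k` generating up to radical, and residual sets `R_j ⊆ M′` outside which every
pinned producer node of `W_j = M′[O, e⁻¹ y_j]` is principal: there is an atlas `𝔄′` on `M′` with
`F_𝔄′ ⊆ π′⁻¹(F_𝔄 ∖ O) ∪ ⋃_j (W_j ∩ R_j)`. [OURS · L1 W4.5c · R-F15b (1)/(3)/(6), A-KF v1 §2.1] -/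
theorem exists_moveAtlas [Finite G] (hp : 0 < p) (hG : ∀ g : G, g ∈ Subgroup.zpowers g₀) (M M' : GModel p q G ρ g₀) (𝔄 : NodeAtlasData p M.act g₀)
    (𝒦 : ReesFiltration M.V) (d : ℕ) (h𝒦G : ∀ g : G, (𝒦.ideal d).comap (M.act.aut g).hom = 𝒦.ideal d)
    (π' : M'.V ⟶ M.V) (hbl : IsBlowup π' (𝒦.ideal d)) (hr : M'.r = π' ≫ M.r)
    (hcomm : ∀ g : G, (M'.act.aut g).hom ≫ π' = π' ≫ (M.act.aut g).hom)
    (O : M.act.StableAffineOpens) (hO : IsAffineOpen O.1) (hsuppO : ((𝒦.ideal d).support : Set M.V) ⊆ O.1)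
    {m : ℕ} (r : Fin m → ℕ) {B : Type} [CommRing B] (𝒜 : (Π j : Fin m, ZMod (r j)) → AddSubgroup B) [GradedRing 𝒜] (σ : B ≃+* B)
    (e : Γ(M.V, O.1) ≃+* ↥(𝒜 0)) (htame : IsTameNode p B 𝒜 σ) (hσp : ∀ x : B, (⇑σ)^[p] x = x)
    (hσ : ∀ t : Γ(M.V, O.1), ((e ((M.act.aut g₀⁻¹).hom.appLE O.1 O.1 (O.2.1 g₀⁻¹).ge t) : ↥(𝒜 0)) : B) = σ ((e t : ↥(𝒜 0)) : B))
    {c : ℕ} (f : Fin c → B) {δ : Fin c → Π j : Fin m, ZMod (r j)} (w : Fin c → ℕ) (hf : ∀ i, f i ∈ 𝒜 (δ i)) (hw : ∀ i, 0 < w i)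
    (hK1 : RingTheory.Sequence.IsRegular B (List.ofFn f)) (hK1' : IsRegularRing (B ⧸ Ideal.span (Set.range f)))
    (hσJ : ∀ n : ℕ, ((weightedFiltration f w).ideal n).map (σ : B →+* B) ≤ (weightedFiltration f w).ideal n)
    (h𝒦O : ∀ n : ℕ, (𝒦.filtration ⟨O.1, hO⟩).ideal n = ((traceFiltration 𝒜 f w).ideal n).comap (e : Γ(M.V, O.1) →+* ↥(𝒜 0)))
    (hver : VeroneseNormalised 𝒜 f w d)
    {k : ℕ} (hk0 : k ≠ 0) {L : ℕ} (y : Fin L → ↥(𝒜 0)) (hy : ∀ j, y j ∈ (traceFiltration 𝒜 f w).ideal (d * k))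
    (hσy : ∀ j, σ (y j : B) = y j)
    (hrad : ∀ i : Fin c, cobordantAlgebra.u' f w i ∈ (Ideal.span (Set.range fun j => coverElement 𝒜 f w (d * k) (y j) (hy j))).radical)
    (R : Fin L → Set M'.V)
    (hR : ∀ (j : Fin L) (O' : M'.act.StableAffineOpens), O'.1 = blowupChart π' ((𝒦.ideal d) ^ k) ⟨O.1, hO⟩ (e.symm (y j)) →
      ∀ (hO'aff : IsAffineOpen O'.1) (hle : O'.1 ≤ π' ⁻¹ᵁ O.1),
      letI := chartNodeGradedRing r 𝒜 f w hf (d * k) (y j) (hy j)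
      ∀ (E : Γ(M'.V, O'.1) ≃+* ↥(chartNodeGrading r 𝒜 f w hf (d * k) (y j) (hy j) 0))
        (htame' : IsTameNode p (ChartRing 𝒜 f w (d * k) (y j) (hy j)) (chartNodeGrading r 𝒜 f w hf (d * k) (y j) (hy j))
          (sigmaChart 𝒜 f w (d * k) (y j) (hy j) σ hσJ hp hσp (hσy j)))
        (hE : ∀ t' : Γ(M'.V, O'.1),
          ((E ((M'.act.aut g₀⁻¹).hom.appLE O'.1 O'.1 (O'.2.1 g₀⁻¹).ge t') : ↥(chartNodeGrading r 𝒜 f w hf (d * k) (y j) (hy j) 0)) :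
              ChartRing 𝒜 f w (d * k) (y j) (hy j)) =
            sigmaChart 𝒜 f w (d * k) (y j) (hy j) σ hσJ hp hσp (hσy j)
              ((E t' : ↥(chartNodeGrading r 𝒜 f w hf (d * k) (y j) (hy j) 0)) : ChartRing 𝒜 f w (d * k) (y j) (hy j))),
        (∀ x : Γ(M.V, O.1), ((E (π'.appLE O.1 O'.1 hle x) : ↥(chartNodeGrading r 𝒜 f w hf (d * k) (y j) (hy j) 0)) :
            ChartRing 𝒜 f w (d * k) (y j) (hy j)) = toChartRing 𝒜 f w (d * k) (y j) (hy j) (e x)) →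
        ∀ v' ∈ O'.1, v' ∉ R j →
          ({ affine := hO'aff, m := m + 1, r := Fin.cons 0 r, B := ChartRing 𝒜 f w (d * k) (y j) (hy j),
              𝒜 := chartNodeGrading r 𝒜 f w hf (d * k) (y j) (hy j), σ := sigmaChart 𝒜 f w (d * k) (y j) (hy j) σ hσJ hp hσp (hσy j), e := E,
              tame := htame', intertwine := hE } : NodeData p M'.act g₀ O').PrincipalNear v') :
    ∃ 𝔄' : NodeAtlasData p M'.act g₀,
      𝔄'.fLocus ⊆ π'.base ⁻¹' (𝔄.fLocus \ (O.1 : Set M.V)) ∪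
        ⋃ j, ((blowupChart π' ((𝒦.ideal d) ^ k) ⟨O.1, hO⟩ (e.symm (y j)) : Set M'.V)) ∩ R j := by
  classical
  haveI := M.isIntegral
  have hverbar : VeroneseNormalised 𝒜 f w (d * k) := veroneseNormalised_mul 𝒜 f w hver (Nat.pos_of_ne_zero hk0)
  have hπ' : IsBlowup π' ((𝒦.ideal d) ^ k) := isBlowup_pow hbl hk0
  have hJ' : ((𝒦.ideal d) ^ k).ideal ⟨O.1, hO⟩ = ((traceFiltration 𝒜 f w).ideal (d * k)).comap (e : Γ(M.V, O.1) →+* ↥(𝒜 0)) := by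
    rw [Scheme.IdealSheafData.ideal_pow, Pi.pow_apply, ← ReesFiltration.filtration_ideal, h𝒦O d, hver.2 k, comap_equiv_pow]
  have hcovW := iSup_blowupChart_eq_preimage (I := 𝒦.ideal d) M.act r 𝒜 f w hf O hO e hπ' hverbar hJ' y hy hrad
  have hρk : ∀ g : G, ((𝒦.ideal d) ^ k).comap (M.act.aut g).hom = (𝒦.ideal d) ^ k := fun g => by rw [comap_pow, h𝒦G g]
  -- the producer charts `W_j` and their exposed, pinned nodes
  have hxJ : ∀ j, e.symm (y j) ∈ ((𝒦.ideal d) ^ k).ideal ⟨O.1, hO⟩ := fun j => by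
    rw [hJ', Ideal.mem_comap, RingHom.coe_coe, e.apply_symm_apply]; exact hy j
  have hfix : ∀ (j) (g : G), (M.act.aut g).hom.appLE O.1 O.1 (O.2.1 g).ge (e.symm (y j)) = e.symm (y j) := fun j g => by
    have hfix₀ : (M.act.aut g₀⁻¹).hom.appLE O.1 O.1 (O.2.1 g₀⁻¹).ge (e.symm (y j)) = e.symm (y j) := by
      apply e.injective
      apply Subtype.ext
      rw [hσ (e.symm (y j)), e.apply_symm_apply]
      exact hσy j
    exact appLE_aut_eq_self_of_mem_zpowers M.act O.1 O.2.1 hfix₀ (by rw [Subgroup.zpowers_inv]; exact hG g)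
  have hW : ∀ j, ∃ O' : M'.act.StableAffineOpens, O'.1 = blowupChart π' ((𝒦.ideal d) ^ k) ⟨O.1, hO⟩ (e.symm (y j)) ∧ IsAffineOpen O'.1 := fun j =>
    exists_stable_blowupChart M.act hπ' M'.act hr hcomm hρk O hO (e.symm (y j)) (hxJ j) (hfix j)
  choose OW hOWeq hOWaff using hW
  have hWle : ∀ j, (OW j).1 ≤ π' ⁻¹ᵁ O.1 := fun j => by rw [hOWeq j]; exact blowupChart_le_preimage π' _ ⟨O.1, hO⟩ _
  have hnode : ∀ j, letI := chartNodeGradedRing r 𝒜 f w hf (d * k) (y j) (hy j)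
      ∃ E : Γ(M'.V, (OW j).1) ≃+* ↥(chartNodeGrading r 𝒜 f w hf (d * k) (y j) (hy j) 0),
        IsTameNode p (ChartRing 𝒜 f w (d * k) (y j) (hy j)) (chartNodeGrading r 𝒜 f w hf (d * k) (y j) (hy j))
          (sigmaChart 𝒜 f w (d * k) (y j) (hy j) σ hσJ hp hσp (hσy j)) ∧
        (∀ t' : Γ(M'.V, (OW j).1),
          ((E ((M'.act.aut g₀⁻¹).hom.appLE (OW j).1 (OW j).1 ((OW j).2.1 g₀⁻¹).ge t') : ↥(chartNodeGrading r 𝒜 f w hf (d * k) (y j) (hy j) 0)) :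
              ChartRing 𝒜 f w (d * k) (y j) (hy j)) =
            sigmaChart 𝒜 f w (d * k) (y j) (hy j) σ hσJ hp hσp (hσy j)
              ((E t' : ↥(chartNodeGrading r 𝒜 f w hf (d * k) (y j) (hy j) 0)) : ChartRing 𝒜 f w (d * k) (y j) (hy j))) ∧
        ∀ (hle : (OW j).1 ≤ π' ⁻¹ᵁ O.1) (x : Γ(M.V, O.1)),
          ((E (π'.appLE O.1 (OW j).1 hle x) : ↥(chartNodeGrading r 𝒜 f w hf (d * k) (y j) (hy j) 0)) : ChartRing 𝒜 f w (d * k) (y j) (hy j)) =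
            toChartRing 𝒜 f w (d * k) (y j) (hy j) (e x) := fun j =>
    exists_nodeData_blowupChart_pin M.act M'.act hcomm g₀ r 𝒜 f w hf hp O hO σ e htame hσp hσ hw hK1 hK1' hσJ hπ' hverbar hJ'
      (y j) (hy j) (hσy j) (OW j) (hOWeq j)
  choose E htame' hE hpin using hnode
  let DW : ∀ j, NodeData p M'.act g₀ (OW j) := fun j =>
    letI := chartNodeGradedRing r 𝒜 f w hf (d * k) (y j) (hy j)
    { affine := hOWaff j, m := m + 1, r := Fin.cons 0 r, B := ChartRing 𝒜 f w (d * k) (y j) (hy j),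
      𝒜 := chartNodeGrading r 𝒜 f w hf (d * k) (y j) (hy j), σ := sigmaChart 𝒜 f w (d * k) (y j) (hy j) σ hσJ hp hσp (hσy j), e := E j,
      tame := htame' j, intertwine := hE j }
  have hDW : ∀ j, ∀ v' ∈ (OW j).1, v' ∉ R j → (DW j).PrincipalNear v' := fun j v' hv' hR' =>
    hR j (OW j) (hOWeq j) (hOWaff j) (hWle j) (E j) (htame' j) (hE j) (hpin j (hWle j)) v' hv' hR'
  -- the old charts, restricted to invariant basic opens off the support and transferred
  let J : Type := Σ i : 𝔄.ι, {b : Γ(M.V, (𝔄.O i).1) // (∀ g : G, actO M.act (𝔄.O i) g b = b) ∧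
      Disjoint ((M.V.basicOpen b : Set M.V)) (((𝒦.ideal d).support : Set M.V))}
  have hiso : ∀ jj : J, IsIso (π' ∣_ (basicOpenStable M.act (𝔄.O jj.1) (𝔄.D jj.1).affine jj.2.2.1).1) := fun jj =>
    hbl.isIso_morphismRestrict jj.2.2.2
  let OJ : J → M'.act.StableAffineOpens := fun jj =>
    haveI := hiso jj; NodeData.preimageStable M.act M'.act π' hr hcomm (basicOpenStable M.act (𝔄.O jj.1) (𝔄.D jj.1).affine jj.2.2.1)
  let DJ : ∀ jj : J, NodeData p M'.act g₀ (OJ jj) := fun jj =>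
    haveI := hiso jj; ((𝔄.D jj.1).restrict jj.2.2.1).transfer M.act M'.act π' hr hcomm
  have hJ : ∀ (jj : J) (v' : M'.V), (DJ jj).PrincipalNear v' ↔ π'.base v' ∈ M.V.basicOpen jj.2.1 ∧ (𝔄.D jj.1).PrincipalNear (π'.base v') := by
    intro jj v'
    haveI := hiso jj
    have h1 := NodeData.principalNear_transfer_iff M.act M'.act π' hr hcomm ((𝔄.D jj.1).restrict jj.2.2.1) v'
    constructor
    · intro h
      have h2 := h1.mp h
      have hub : π'.base v' ∈ M.V.basicOpen jj.2.1 := ((𝔄.D jj.1).restrict jj.2.2.1).mem_of_principalNear h2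
      exact ⟨hub, ((𝔄.D jj.1).principalNear_restrict_iff jj.2.2.1 hub).mp h2⟩
    · rintro ⟨hub, h⟩
      exact h1.mpr (((𝔄.D jj.1).principalNear_restrict_iff jj.2.2.1 hub).mpr h)
  have hoffb : ∀ u : M.V, u ∉ (O.1 : Set M.V) → ∀ i, u ∈ (𝔄.O i).1 →
      ∃ b : Γ(M.V, (𝔄.O i).1), (∀ g : G, actO M.act (𝔄.O i) g b = b) ∧ u ∈ M.V.basicOpen b ∧
        Disjoint ((M.V.basicOpen b : Set M.V)) (((𝒦.ideal d).support : Set M.V)) := by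
    intro u hu i hi
    have hsupp : u ∈ ((((𝒦.ideal d).support.compl : M.V.Opens)) : Set M.V) := fun h => hu (hsuppO h)
    obtain ⟨b, hb, hub, hle⟩ := GoodCharts.exists_invariant_basicOpen M.act (𝔄.O i) (𝔄.D i).affine hi (𝒦.ideal d).support.compl
      (preimage_support_compl_of_comap_eq M h𝒦G) hsupp
    exact ⟨b, hb, hub, Set.disjoint_left.mpr fun x hx hx' => (hle hx) hx'⟩
  -- the atlas
  let 𝔄' : NodeAtlasData p M'.act g₀ :=
    { ι := J ⊕ Fin L
      O := Sum.elim OJ OW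
      D := fun x => match x with
        | Sum.inl jj => DJ jj
        | Sum.inr j => DW j
      cover := fun v' => by
        by_cases hv : π'.base v' ∈ O.1
        · have hv'W : v' ∈ ⨆ j, blowupChart π' ((𝒦.ideal d) ^ k) ⟨O.1, hO⟩ (e.symm (y j)) := by rw [hcovW]; exact hv
          obtain ⟨j, hj⟩ := Opens.mem_iSup.mp hv'W
          exact ⟨Sum.inr j, by rw [show (Sum.elim OJ OW (Sum.inr j)) = OW j from rfl, hOWeq j]; exact hj⟩
        · obtain ⟨i, hi⟩ := 𝔄.cover (π'.base v')
          obtain ⟨b, hb, hub, hdisj⟩ := hoffb _ hv i hi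
          exact ⟨Sum.inl ⟨i, b, hb, hdisj⟩, hub⟩ }
  refine ⟨𝔄', fun v' hv' => ?_⟩
  by_cases hv : π'.base v' ∈ O.1
  · -- over the centre chart: in some producer chart, outside whose residual set the node is principal
    have hv'W : v' ∈ ⨆ j, blowupChart π' ((𝒦.ideal d) ^ k) ⟨O.1, hO⟩ (e.symm (y j)) := by rw [hcovW]; exact hv
    obtain ⟨j, hj⟩ := Opens.mem_iSup.mp hv'W
    refine Or.inr (Set.mem_iUnion.mpr ⟨j, hj, ?_⟩)
    by_contra hRj
    have hvO : v' ∈ (OW j).1 := by rw [hOWeq j]; exact hj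
    exact (NodeAtlasData.mem_fLocus_iff v').mp hv' (Sum.inr j) hvO (hDW j v' hvO hRj)
  · -- off the centre chart: the old atlas decides
    refine Or.inl ⟨?_, hv⟩
    by_contra hF
    obtain ⟨i, hPi⟩ := (NodeAtlasData.not_mem_fLocus_iff (π'.base v')).mp hF
    obtain ⟨b, hb, hub, hdisj⟩ := hoffb _ hv i ((𝔄.D i).mem_of_principalNear hPi)
    exact (NodeAtlasData.mem_fLocus_iff v').mp hv' (Sum.inl ⟨i, b, hb, hdisj⟩) hub ((hJ ⟨i, b, hb, hdisj⟩ v').mpr ⟨hub, hPi⟩)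

/-- **Tracked form**: with any known upper bound `T ⊇ F_𝔄` downstairs, `F_𝔄′ ⊆ π′⁻¹(T ∖ O) ∪ ⋃_j (W_j ∩ R_j)` (X-scheme bookkeeping, A-KF v1 §2.1 (ii)). -/
theorem fLocus_subset_of_moveAtlas_bound {M M' : GModel p q G ρ g₀} {𝔄 : NodeAtlasData p M.act g₀} {𝔄' : NodeAtlasData p M'.act g₀}
    {π' : M'.V ⟶ M.V} {O T : Set M.V} {L : ℕ} {W R : Fin L → Set M'.V}
    (h : 𝔄'.fLocus ⊆ π'.base ⁻¹' (𝔄.fLocus \ O) ∪ ⋃ j, W j ∩ R j) (hT : 𝔄.fLocus ⊆ T) :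
    𝔄'.fLocus ⊆ π'.base ⁻¹' (T \ O) ∪ ⋃ j, W j ∩ R j := by
  exact h.trans (Set.union_subset_union_left _ (Set.preimage_mono fun x hx => ⟨hT hx.1, hx.2⟩))

end Summit.ResolutionOfSingularities.ResolutionOfSingularities.Theorems.WildQuotientResolution.S1.GameFrame.GModel

end
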